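import Literature.NumberTheory.Automorphic.PadicCoeffUnitBallLattice
import Literature.NumberTheory.Automorphic.AdelicStabilizerArithmetic
import Literature.NumberTheory.Automorphic.UnramifiedLevelChange
import Literature.NumberTheory.NumberFields.CongruenceSubgroupTorsionFree
import Literature.NumberTheory.Automorphic.IwahoriGL
import HarnessLib

/-!
# Levels contained in `K_f(p²)` have torsion-free stabilisers `Γ_x = GL_n(K) ∩ x U x⁻¹`

Topic `NumberTheory/Automorphic`; namespace `Literature.NumberTheory.Automorphic`.  Theorems only;
no definition, no named fact, no instance, no `sorry`.

Minkowski's lemma at ONE place and at level `p²` (which also covers `p = 2`): if `g ≡ 1 mod p²`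
at a place `w ∣ p` and `g` has finite order then `g = 1`
([Brown1982CohomologyGroups, II.4 Exercise 3]: "`Γ(N)` is torsion-free for `N ≥ 3` … look at the
binomial expansion of `(1 + p^d B)^l`"; [Serre1971CohomologieGroupesDiscrets, §1.8]).  Consequently,
for every level `U ≤ K_f(p²)` of `GL_n(𝔸_K^∞)` and every `x`, the arithmetic group
`Γ_x = {γ ∈ GL_n(K) | γ x U = x U} = GL_n(K) ∩ x U x⁻¹` is TORSION-FREE
(`TwistedQuotient.eq_one_of_isOfFinOrder_of_mem_orbitStabilizer`): the `w`-component of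
`x⁻¹ γ x ∈ U` is `≡ 1 mod p²`.  This is the "neat level" input making the stabilisers of the
components of `X_U` torsion-free arithmetic groups, to which [BorelSerre1973, §11.1 (c)] applies.

* `Matrix.eq_zero_of_one_add_pow_prime_eq_one_sq` — the valuation-theoretic core at level `p²`
  for ANY prime `p` (the tree's `Matrix.eq_zero_of_one_add_pow_prime_eq_one` is level `p`, `p` odd):
  `v ≤ 1` on `R`, `v(p) < 1`, `v(Y_{ij}) ≤ v(p)²`, `(1 + Y)^ℓ = 1` (`ℓ` prime) ⟹ `Y = 0`;
* `BigHeckeGLn.eq_one_of_isOfFinOrder_of_conj_mem` — `γ ∈ GL_n(K)` of finite order with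
  `x⁻¹ γ x ∈ K_f(p²)` is `1`;
* `TwistedQuotient.eq_one_of_isOfFinOrder_of_mem_orbitStabilizer` — `Γ_x` is torsion-free for
  `U ≤ K_f(p²)`.

## References

* K. S. Brown, *Cohomology of Groups*, GTM 87 (1982), II.4 Exercise 3. [Brown1982CohomologyGroups]
* J.-P. Serre, *Cohomologie des groupes discrets*, Ann. of Math. Studies 70 (1971), §1.8.
  [Serre1971CohomologieGroupesDiscrets]
* A. Borel, J.-P. Serre, *Corners and arithmetic groups*, Comment. Math. Helv. 48 (1973), 11.3–11.4.
  [BorelSerre1973]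
-/

noncomputable section

open scoped NumberField MatrixGroups
open IsDedekindDomain NumberField

namespace Literature.NumberTheory.Automorphic

/-! ### The valuation-theoretic core at level `p²` -/

namespace Matrix

open Literature.NumberTheory.NumberFields Literature.NumberTheory.NumberFields.Matrix

variable {R : Type*} [CommRing R] {Γ₀ : Type*} [LinearOrderedCommGroupWithZero Γ₀]
  (v : Valuation R Γ₀) {n : Type*} [Fintype n] [DecidableEq n]

/-- **Minkowski at level `p²`, any prime `p`.**  `v ≤ 1` on `R`, `v(p) < 1`, `v(Y_{ij}) ≤ v(p)²`
for all `i, j` and `(1 + Y)^ℓ = 1` for a prime `ℓ` imply `Y = 0`: with `M = max v(Y_{ij})`,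
`ℓ Y_{ij} = -(C(ℓ,2) Y² + Y³ Z)_{ij}` has valuation `≤ M² < v(ℓ) M` (`v(ℓ) = 1` if `ℓ ≠ p`,
`v(ℓ) = v(p) > v(p)² ≥ M` if `ℓ = p`). [cite: Brown1982CohomologyGroups, II.4 Exercise 3] -/
theorem eq_zero_of_one_add_pow_prime_eq_one_sq (hv : ∀ x, v x ≤ 1) (hv₀ : ∀ x, v x = 0 → x = 0)
    {p : ℕ} (hp : p.Prime) (hvp : v p < 1) {Y : _root_.Matrix n n R}
    (hY : ∀ i j, v (Y i j) ≤ v p * v p) {ℓ : ℕ} (hℓ : ℓ.Prime) (hpow : (1 + Y) ^ ℓ = 1) :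
    Y = 0 := by
  classical
  by_contra hY0
  have hne : (Finset.univ : Finset (n × n)).Nonempty := by
    by_contra h
    rw [Finset.not_nonempty_iff_eq_empty, Finset.univ_eq_empty_iff] at h
    exact hY0 (_root_.Matrix.ext fun i j => (h.false (i, j)).elim)
  obtain ⟨⟨i, j⟩, -, hmax⟩ :=
    Finset.exists_max_image Finset.univ (fun ij : n × n => v (Y ij.1 ij.2)) hne
  set M := v (Y i j) with hMdef
  have hM : ∀ i' j', v (Y i' j') ≤ M := fun i' j' => hmax (i', j') (Finset.mem_univ _)
  have hM0 : M ≠ 0 := by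
    intro hM0
    exact hY0 (_root_.Matrix.ext fun i' j' => hv₀ _ (le_antisymm (hM0 ▸ hM i' j') zero_le))
  have hMpos : 0 < M := zero_lt_iff.2 hM0
  have hMp2 : M ≤ v p * v p := hY i j
  have hp0 : v p ≠ 0 := fun h => hM0 (le_antisymm (by simpa [h] using hMp2) zero_le)
  have hpp : v p * v p < v p := by
    calc v p * v p < 1 * v p := mul_lt_mul_of_pos_right hvp (zero_lt_iff.2 hp0)
      _ = v p := one_mul _
  have hMp : M < v p := hMp2.trans_lt hpp
  have hM1 : M < 1 := hMp.trans hvp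
  have hMM : M * M < M := by
    calc M * M < 1 * M := mul_lt_mul_of_pos_right hM1 hMpos
      _ = M := one_mul M
  have hMMM : M * M * M ≤ M * M :=
    calc M * M * M ≤ M * M * 1 := mul_le_mul' le_rfl hM1.le
      _ = M * M := mul_one _
  -- entry bounds for `Y²`, `Y³ Z`
  have hY2 : ∀ i' j', v ((Y ^ 2) i' j') ≤ M * M := fun i' j' => by
    rw [pow_two]; exact valuation_mul_apply_le v hM hM i' j'
  have hY3 : ∀ (Z : _root_.Matrix n n R) i' j', v ((Y ^ 3 * Z) i' j') ≤ M * M * M :=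
    fun Z i' j' => by
      have h := valuation_mul_apply_le v (a := M * M * M) (b := 1) (A := Y ^ 3) (B := Z)
        (fun i'' j'' => by
          rw [pow_succ]
          exact valuation_mul_apply_le v hY2 hM i'' j'') (fun _ _ => hv _) i' j'
      rwa [mul_one] at h
  -- the expansion `ℓ Y + C(ℓ,2) Y² + Y³ Z = 0`, entry `(i, j)`
  obtain ⟨Z, hZ⟩ := exists_one_add_pow_eq Y ℓ
  rw [hpow, add_assoc, add_assoc, left_eq_add] at hZ
  have hij : (ℓ : R) * Y i j + ((ℓ.choose 2 : R) * (Y ^ 2) i j + (Y ^ 3 * Z) i j) = 0 := by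
    have h := congrFun (congrFun hZ i) j
    simp only [_root_.Matrix.add_apply, _root_.Matrix.smul_apply, _root_.Matrix.zero_apply] at h
    rwa [nsmul_eq_mul, nsmul_eq_mul] at h
  have hkey : (ℓ : R) * Y i j = -((ℓ.choose 2 : R) * (Y ^ 2) i j + (Y ^ 3 * Z) i j) :=
    eq_neg_of_add_eq_zero_left hij
  have hle : v ((ℓ : R) * Y i j) ≤ M * M := by
    rw [hkey, Valuation.map_neg]
    refine (v.map_add _ _).trans (max_le ?_ ((hY3 Z i j).trans hMMM))
    rw [map_mul]
    calc v (ℓ.choose 2 : R) * v ((Y ^ 2) i j) ≤ 1 * (M * M) := mul_le_mul' (hv _) (hY2 i j)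
      _ = M * M := one_mul _
  rw [map_mul] at hle
  -- `v ℓ * M ≤ M * M < v ℓ * M`
  have hvl : M < v (ℓ : R) := by
    by_cases hℓp : ℓ = p
    · subst hℓp; exact hMp
    · -- `v ℓ = 1` by Bezout
      have hvℓ : v (ℓ : R) = 1 := by
        refine le_antisymm (hv _) (not_lt.1 fun hlt => ?_)
        have hcop : Nat.Coprime ℓ p := (Nat.coprime_primes hℓ hp).2 hℓp
        have hbez := Nat.gcd_eq_gcd_ab ℓ p
        rw [hcop.gcd_eq_one, Nat.cast_one] at hbez
        have h1 : (1 : R) = (ℓ : R) * (ℓ.gcdA p : R) + (p : R) * (ℓ.gcdB p : R) := by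
          have h := congrArg (Int.cast : ℤ → R) hbez
          push_cast at h
          exact h
        have : v (1 : R) < 1 := by
          rw [h1]
          refine (v.map_add _ _).trans_lt (max_lt ?_ ?_)
          · rw [map_mul]
            calc v (ℓ : R) * v (ℓ.gcdA p : R) ≤ v (ℓ : R) * 1 := mul_le_mul' le_rfl (hv _)
              _ < 1 := by rwa [mul_one]
          · rw [map_mul]
            calc v (p : R) * v (ℓ.gcdB p : R) ≤ v (p : R) * 1 := mul_le_mul' le_rfl (hv _)
              _ < 1 := by rwa [mul_one]
        rw [map_one] at this
        exact lt_irrefl _ this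
      rw [hvℓ]; exact hM1
  have hlt : M * M < v (ℓ : R) * M := mul_lt_mul_of_pos_right hvl hMpos
  exact absurd (hle.trans_lt hlt) (lt_irrefl _)

end Matrix

/-! ### Finite-order elements of `GL_n(K)` conjugate into `K_f(p²)` are trivial -/

namespace BigHeckeGLn

open Literature.NumberTheory.NumberFields ResGLnCohomology

variable {n : ℕ} {K : Type} [Field K] [NumberField K] (p : ℕ) [Fact p.Prime]

/-- `GL_n(f)` is injective for an injective ring map `f`: a local copy of
`Literature.NumberTheory.Automorphic.generalLinearGroup_map_injective` (`IwahoriGL.lean`, the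
area's copy; further copies live in `EssConjSelfDual`, `SiegelMultiplicity` (private),
`EllipticCurves/NewformGaloisRepModLProofs`, `GaloisRepresentations/NearlyOrdinaryDeformationRingProofs`
— librarian SWEEP g29 item 1), kept as a deprecated alias (dedup-02458). [folklore] -/
@[deprecated Literature.NumberTheory.Automorphic.generalLinearGroup_map_injective (since := "2026-08-16")]
theorem generalLinearGroup_map_injective {A B : Type*} [CommRing A] [CommRing B] (f : A →+* B)
    (hf : Function.Injective f) {m : Type*} [Fintype m] [DecidableEq m] :
    Function.Injective (Matrix.GeneralLinearGroup.map (n := m) f) :=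
  Literature.NumberTheory.Automorphic.generalLinearGroup_map_injective f hf

/-- **An element of `GL_n(K)` of finite order which is conjugate (in `GL_n(𝔸_K^∞)`) into `K_f(p²)`
is trivial** (Minkowski at a place `w ∣ p`, level `p²`).
[cite: Brown1982CohomologyGroups, II.4 Exercise 3] [cite: Serre1971CohomologieGroupesDiscrets, §1.8] -/
theorem eq_one_of_isOfFinOrder_of_conj_mem {γ : GL (Fin n) K} (hγ : IsOfFinOrder γ)
    (x : FiniteAdelicGL n K)
    (hmem : x⁻¹ * globalEmbedding n K γ * x ∈
      (principalCongruenceLevel n K (Ideal.span {((p : ℕ) : 𝓞 K)} ^ 2)).comap (GLn.ofFinite n K)) :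
    γ = 1 := by
  classical
  have hp : p.Prime := Fact.out
  -- conjugation by `x⁻¹` after the global embedding
  let c : GL (Fin n) K →* FiniteAdelicGL n K :=
    (MulAut.conj x⁻¹).toMonoidHom.comp (globalEmbedding n K)
  have hc : ∀ g, c g = x⁻¹ * globalEmbedding n K g * x := fun g => by
    simp [c]
  let Uc : Subgroup (FiniteAdelicGL n K) :=
    (principalCongruenceLevel n K (Ideal.span {((p : ℕ) : 𝓞 K)} ^ 2)).comap (GLn.ofFinite n K)
  have hmem' : c γ ∈ Uc := by rw [hc]; exact hmem
  -- reduce to prime order `ℓ`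
  by_contra hγ1
  set d := orderOf γ with hd
  have hdpos : 0 < d := hγ.orderOf_pos
  have hd1 : d ≠ 1 := fun h => hγ1 (orderOf_eq_one_iff.1 h)
  set ℓ := d.minFac with hℓdef
  have hℓ : ℓ.Prime := Nat.minFac_prime hd1
  have hℓd : ℓ ∣ d := Nat.minFac_dvd d
  set γ' := γ ^ (d / ℓ) with hγ'
  have hdl0 : d / ℓ ≠ 0 := (Nat.div_pos (Nat.le_of_dvd hdpos hℓd) hℓ.pos).ne'
  have hord : orderOf γ' = ℓ := by
    rw [hγ', orderOf_pow_of_dvd hdl0 (Nat.div_dvd_of_dvd hℓd), Nat.div_div_self hℓd hdpos.ne']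
  have hγ'1 : γ' ≠ 1 := fun h => hℓ.one_lt.ne' (by rw [← hord, h, orderOf_one])
  have hγ'pow : γ' ^ ℓ = 1 := by rw [← hord, pow_orderOf_eq_one]
  have hu' : c γ' ∈ Uc := by rw [hγ', map_pow]; exact pow_mem hmem' _
  -- a place `w ∣ p` and the `w`-component `g_w ≡ 1 mod p²`
  obtain ⟨w, hw⟩ := RingOfIntegers.exists_heightOneSpectrum_natCast_mem K hp
  let gw : GL (Fin n) (w.adicCompletion K) := localComponent n K w (c γ')
  have h𝔫 : (Ideal.span {((p : ℕ) : 𝓞 K)} ^ 2 : Ideal (𝓞 K)) ≠ 0 :=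
    pow_ne_zero 2 (by
      rw [Ne, Ideal.zero_eq_bot, Ideal.span_singleton_eq_bot]
      exact_mod_cast hp.ne_zero)
  have hgw : gw ∈ valuedCongruenceSubgroup (Fin n)
      (idealRadius K w (Ideal.span {((p : ℕ) : 𝓞 K)} ^ 2)) := by
    have h := (mem_principalCongruenceLevel_iff.1 (Subgroup.mem_comap.1 hu')).2 w
    rwa [← localComponent_sndHom, GLn.sndHom_ofFinite] at h
  have hrad : idealRadius K w (Ideal.span {((p : ℕ) : 𝓞 K)} ^ 2) =
      Valued.v ((p : w.adicCompletion K)) * Valued.v ((p : w.adicCompletion K)) := by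
    rw [idealRadius_span_natCast_pow p w hp.ne_zero 2, pow_two]
  obtain ⟨hgw₁, -, hgw₃⟩ := hgw
  -- the integral matrices `A = g_w`, `Y = g_w - 1` over `𝒪_w`
  let R := w.adicCompletionIntegers K
  let vR : Valuation R (WithZero (Multiplicative ℤ)) := Valued.v.comap R.subtype
  have hvR : ∀ z : R, vR z ≤ 1 := fun z =>
    (HeightOneSpectrum.mem_adicCompletionIntegers (R := 𝓞 K) K w).1 z.2
  have hvR₀ : ∀ z : R, vR z = 0 → z = 0 := fun z hz =>
    Subtype.ext ((Valuation.zero_iff (Valued.v : Valuation (w.adicCompletion K) _)).1 hz)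
  have hvRp : vR p < 1 := by
    change Valued.v ((R.subtype : R →+* w.adicCompletion K) p) < 1
    rw [map_natCast, valued_natCast_eq_intValuation, HeightOneSpectrum.intValuation_lt_one_iff_mem]
    exact hw
  have hvRp' : vR p = Valued.v ((p : w.adicCompletion K)) := by
    change Valued.v ((R.subtype : R →+* w.adicCompletion K) p) = _
    rw [map_natCast]
  have hp1 : Valued.v ((p : w.adicCompletion K)) ≤ 1 := by rw [← hvRp']; exact hvR _
  let Y : _root_.Matrix (Fin n) (Fin n) R := fun i j =>
    ⟨((gw : _root_.Matrix (Fin n) (Fin n) (w.adicCompletion K)) - 1) i j,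
      (HeightOneSpectrum.mem_adicCompletionIntegers (R := 𝓞 K) K w).2
        ((hgw₃ i j).trans (by rw [hrad]; exact mul_le_one' hp1 hp1))⟩
  have hY : ∀ i j, vR (Y i j) ≤ vR p * vR p := fun i j => by
    rw [hvRp', ← hrad]; exact hgw₃ i j
  have hmapY : R.subtype.mapMatrix (1 + Y) = (gw : _root_.Matrix (Fin n) (Fin n) (w.adicCompletion K)) := by
    refine _root_.Matrix.ext fun i j => ?_
    rw [RingHom.mapMatrix_apply, _root_.Matrix.map_apply, _root_.Matrix.add_apply, map_add]
    change R.subtype ((1 : _root_.Matrix (Fin n) (Fin n) R) i j) +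
      ((gw : _root_.Matrix (Fin n) (Fin n) (w.adicCompletion K)) - 1) i j = _
    rw [_root_.Matrix.sub_apply, _root_.Matrix.one_apply, _root_.Matrix.one_apply]
    split_ifs <;> simp
  have hpow : (1 + Y) ^ ℓ = 1 := by
    apply _root_.Matrix.map_injective (f := R.subtype) Subtype.val_injective
    change R.subtype.mapMatrix ((1 + Y) ^ ℓ) = R.subtype.mapMatrix 1
    rw [map_pow, hmapY, map_one, ← Units.val_pow_eq_pow_val, ← map_pow, ← map_pow, hγ'pow,
      map_one, map_one, Units.val_one]
  have hY0 := Matrix.eq_zero_of_one_add_pow_prime_eq_one_sq vR hvR hvR₀ hp hvRp hY hℓ hpow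
  -- hence `g_w = 1`, `γ'_w = 1`, `γ' = 1`
  have hgw1 : gw = 1 := Matrix.GeneralLinearGroup.ext fun i j => by
    have h := congrArg (fun z : R => (z : w.adicCompletion K)) (congrFun (congrFun hY0 i) j)
    change ((gw : _root_.Matrix (Fin n) (Fin n) (w.adicCompletion K)) - 1) i j = ((0 : R) : w.adicCompletion K) at h
    rw [_root_.Matrix.sub_apply, ZeroMemClass.coe_zero, sub_eq_zero] at h
    rw [h, Units.val_one]
  have hloc : localComponent n K w (globalEmbedding n K γ') = 1 := by
    have h1 : globalEmbedding n K γ' = x * c γ' * x⁻¹ := by rw [hc]; group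
    rw [h1, map_mul, map_mul, show localComponent n K w (c γ') = 1 from hgw1, mul_one, ← map_mul,
      mul_inv_cancel, map_one]
  rw [localComponent_globalEmbedding] at hloc
  exact hγ'1 (Literature.NumberTheory.Automorphic.generalLinearGroup_map_injective _
    (algebraMap K (w.adicCompletion K)).injective
    (by rw [hloc, map_one]))

end BigHeckeGLn

/-! ### Stabilisers at a level inside `K_f(p²)` are torsion-free -/

namespace TwistedQuotient

open BigHeckeGLn

variable {n : ℕ} {K : Type} [Field K] [NumberField K] (p : ℕ) [Fact p.Prime]

/-- **`Γ_x = GL_n(K) ∩ x U x⁻¹` is torsion-free for `U ≤ K_f(p²)`.**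
[cite: Serre1971CohomologieGroupesDiscrets, §1.8] [cite: BorelSerre1973, 11.3–11.4] -/
theorem eq_one_of_isOfFinOrder_of_mem_orbitStabilizer {U : Subgroup (FiniteAdelicGL n K)}
    (hU : U ≤ (principalCongruenceLevel n K (Ideal.span {((p : ℕ) : 𝓞 K)} ^ 2)).comap
      (GLn.ofFinite n K))
    (x : FiniteAdelicGL n K) {γ : GL (Fin n) K}
    (hγU : γ ∈ orbitStabilizer (globalEmbedding n K) U (x : FiniteAdelicGL n K ⧸ U))
    (hγ : IsOfFinOrder γ) : γ = 1 := by
  refine eq_one_of_isOfFinOrder_of_conj_mem p hγ x (hU ?_)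
  rw [mem_orbitStabilizer_iff, MulAction.Quotient.smul_coe, QuotientGroup.eq, smul_eq_mul,
    mul_inv_rev] at hγU
  have h := inv_mem hγU
  simpa only [mul_inv_rev, inv_inv, mul_assoc] using h

/-- The same, for elements of the subgroup `Γ_x`. [folklore] -/
theorem orbitStabilizer_torsionFree {U : Subgroup (FiniteAdelicGL n K)}
    (hU : U ≤ (principalCongruenceLevel n K (Ideal.span {((p : ℕ) : 𝓞 K)} ^ 2)).comap
      (GLn.ofFinite n K))
    (x : FiniteAdelicGL n K)
    (g : orbitStabilizer (globalEmbedding n K) U (x : FiniteAdelicGL n K ⧸ U))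
    (hg : IsOfFinOrder g) : g = 1 :=
  Subtype.ext (eq_one_of_isOfFinOrder_of_mem_orbitStabilizer p hU x g.2
    ((Subgroup.subtype _).isOfFinOrder hg))

end TwistedQuotient

end Literature.NumberTheory.Automorphic
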